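import Summits.Schanuel.Schanuel.Theorems.RootDecomp1KHyper55

/-!
# RootDecomp1KHyper — lens 6, generation 17 «BILOG STAIRCASE CELL» (BilogStair.lean edition 2 f0528a77…, 2567 l) — continuation (RootDecomp1KHyper56): §D.3 `DegGrowth` for the member (`uv`, Gaussian-integer bookkeeping, `smallRoots_finite`), §D.4 the member's cell theorem `sb_three_zB_of : TransferI → TransferII → SB 3 zB`

(lens-6 g17 `BilogStair.lean` edition 2, sha256 f0528a77…5850, own farm rc 0 · 0 sorry · axioms std; critic ACK STATUS L1737 PORT GO LOW (registered, no credit);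
port by census-1 gen 15 in ten parts `RootDecomp1KHyper53`–`62` — see the PORT NOTE of part 53; `--supports stmt-Schanuel-33363`; rung 0.)
-/

open Complex Polynomial IntermediateField Filter
open scoped BigOperators

namespace Summit.Schanuel.Schanuel.Theorems.RootDecomp1KHyper

namespace HyperCell

namespace LatCell

namespace Bilog

/-! ### §D.3  `DegGrowth` for the member: `deg γ_k → ∞` (bounded house ⟹ finiteness) -/

/-- Real and imaginary parts of `(3 + 4i)^M`. -/
def uv : ℕ → ℤ × ℤ
  | 0 => (1, 0)
  | M + 1 => (3 * (uv M).1 - 4 * (uv M).2, 4 * (uv M).1 + 3 * (uv M).2)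

/-- `u_M + v_M i = (3 + 4i)^M`. -/
theorem uv_spec (M : ℕ) : (((uv M).1 : ℤ) : ℂ) + (((uv M).2 : ℤ) : ℂ) * I = (3 + 4 * I) ^ M := by
  induction M with
  | zero => simp [uv]
  | succ M ih =>
      simp only [uv]
      push_cast
      rw [pow_succ, ← ih]
      linear_combination (-(4 * ((uv M).2 : ℂ))) * I_sq

/-- `u_M − v_M i = (3 − 4i)^M`. -/
theorem uv_conj (M : ℕ) : (((uv M).1 : ℤ) : ℂ) - (((uv M).2 : ℤ) : ℂ) * I = (3 - 4 * I) ^ M := by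
  induction M with
  | zero => simp [uv]
  | succ M ih =>
      simp only [uv]
      push_cast
      rw [pow_succ, ← ih]
      linear_combination (-(4 * ((uv M).2 : ℂ))) * I_sq

/-- `u_M² + v_M² = 25^M`. -/
theorem uv_normSq (M : ℕ) : ((uv M).1) ^ 2 + ((uv M).2) ^ 2 = (25 : ℤ) ^ M := by
  induction M with
  | zero => simp [uv]
  | succ M ih =>
      simp only [uv]
      rw [pow_succ (25 : ℤ) M, ← ih]
      ring

/-- The power identity: `γ_k ^ (2^{a_k}) = (−1)^{P_k} · α₀^{M_k}`, in the cleared form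
`(5 γ_k)^{2^{a_k}} = (−1)^{P_k} 5^{2^{a_k} − M_k} (3 + 4i)^{M_k}`. -/
theorem gam_pow (k : ℕ) :
    (5 * gam ell aB bB k) ^ (2 ^ hexp k) =
      (-1) ^ pmP k * (5 : ℂ) ^ (2 ^ hexp k - pmM k) * (3 + 4 * I) ^ pmM k := by
  have hE : ((2 ^ hexp k : ℕ) : ℂ) * ((((aB k : ℝ) * Real.pi + (bB k : ℝ) * ell : ℝ) : ℂ) * I) =
      (pmP k : ℂ) * ((Real.pi : ℂ) * I) + (pmM k : ℂ) * ((ell : ℂ) * I) := by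
    unfold aB bB
    push_cast
    field_simp
  rw [mul_pow, gam, ← Complex.exp_nat_mul, hE, Complex.exp_add, Complex.exp_nat_mul, Complex.exp_nat_mul,
    Complex.exp_pi_mul_I, cexp_ell]
  rw [← pow_sub_mul_pow (5 : ℂ) (pmM_le_pow k), div_pow]
  have h5 : (5 : ℂ) ^ pmM k ≠ 0 := pow_ne_zero _ (by norm_num)
  field_simp

/-- `‖3 + 4i‖ = 5`. -/
private theorem norm_three_add_four_I : ‖(3 : ℂ) + 4 * I‖ = 5 := by
  have h := Complex.norm_add_mul_I 3 4
  push_cast at h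
  rw [h, show (3 : ℝ) ^ 2 + 4 ^ 2 = 5 ^ 2 by norm_num, Real.sqrt_sq (by norm_num)]

/-- `i` is an algebraic integer. -/
private theorem isIntegral_I : IsIntegral ℤ I := by
  refine IsIntegral.of_pow (n := 4) (by norm_num) ?_
  rw [show (4 : ℕ) = 2 * 2 from rfl, pow_mul, I_sq]
  norm_num
  exact isIntegral_one

/-- Integers are algebraic integers in `ℂ`. -/
private theorem isIntegral_intCast (n : ℤ) : IsIntegral ℤ (n : ℂ) := by
  simpa using (isIntegral_algebraMap (R := ℤ) (A := ℂ) (x := n))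

/-- The right-hand side `c_k` of the power identity and its conjugate, via `uv`. -/
theorem cB_eq (k : ℕ) :
    (-1 : ℂ) ^ pmP k * (5 : ℂ) ^ (2 ^ hexp k - pmM k) * (3 + 4 * I) ^ pmM k =
      (-1 : ℂ) ^ pmP k * (5 : ℂ) ^ (2 ^ hexp k - pmM k) *
        ((((uv (pmM k)).1 : ℤ) : ℂ) + (((uv (pmM k)).2 : ℤ) : ℂ) * I) := by
  rw [uv_spec]

/-- The rational polynomial `Ξ_k = (X^E − c_k)(X^E − c̄_k) ∈ ℚ[X]`, `E = 2^{a_k}`. -/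
noncomputable def Xi (k : ℕ) : ℚ[X] :=
  X ^ (2 * 2 ^ hexp k)
    - Polynomial.C ((2 : ℚ) * (-1) ^ pmP k * 5 ^ (2 ^ hexp k - pmM k) * ((uv (pmM k)).1 : ℚ)) * X ^ (2 ^ hexp k)
    + Polynomial.C ((5 : ℚ) ^ (2 * 2 ^ hexp k))

/-- The auxiliary polynomial `Ξ_k` is non-zero. -/
theorem Xi_ne_zero (k : ℕ) : Xi k ≠ 0 := by
  intro h
  have hc := congrArg (fun p : ℚ[X] => p.coeff (2 * 2 ^ hexp k)) h
  have hE : (0 : ℕ) < 2 ^ hexp k := Nat.two_pow_pos _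
  have hne1 : (2 * 2 ^ hexp k : ℕ) ≠ 2 ^ hexp k := (lt_two_mul_self hE).ne'
  have hne2 : (2 * 2 ^ hexp k : ℕ) ≠ 0 := by positivity
  simp only [Xi, Polynomial.coeff_add, Polynomial.coeff_sub, Polynomial.coeff_X_pow,
    Polynomial.coeff_C_mul_X_pow, Polynomial.coeff_C, Polynomial.coeff_zero, if_neg hne1, if_neg hne2] at hc
  norm_num at hc

/-- Factorisation of `Ξ_k` over `ℂ` at any point `w`. -/
theorem aeval_Xi (k : ℕ) (w : ℂ) :
    Polynomial.aeval w (Xi k) =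
      (w ^ (2 ^ hexp k) - (-1 : ℂ) ^ pmP k * (5 : ℂ) ^ (2 ^ hexp k - pmM k) *
          ((((uv (pmM k)).1 : ℤ) : ℂ) + (((uv (pmM k)).2 : ℤ) : ℂ) * I)) *
      (w ^ (2 ^ hexp k) - (-1 : ℂ) ^ pmP k * (5 : ℂ) ^ (2 ^ hexp k - pmM k) *
          ((((uv (pmM k)).1 : ℤ) : ℂ) - (((uv (pmM k)).2 : ℤ) : ℂ) * I)) := by
  have hn : ((((uv (pmM k)).1 : ℤ) : ℂ)) ^ 2 + ((((uv (pmM k)).2 : ℤ) : ℂ)) ^ 2 = (25 : ℂ) ^ pmM k := by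
    exact_mod_cast uv_normSq (pmM k)
  have h25 : (25 : ℂ) ^ pmM k = (5 : ℂ) ^ pmM k * (5 : ℂ) ^ pmM k := by rw [← mul_pow]; norm_num
  have hs : ((-1 : ℂ) ^ pmP k) ^ 2 = 1 := by rw [← pow_mul, Nat.mul_comm, pow_mul]; norm_num
  have h55 : (5 : ℂ) ^ (2 * 2 ^ hexp k) = ((5 : ℂ) ^ (2 ^ hexp k - pmM k) * (5 : ℂ) ^ pmM k) ^ 2 := by
    rw [pow_sub_mul_pow (5 : ℂ) (pmM_le_pow k), ← pow_mul, Nat.mul_comm]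
  simp only [Xi, map_add, map_sub, map_mul, map_pow, Polynomial.aeval_X, Polynomial.aeval_C, eq_ratCast]
  push_cast
  rw [h55]
  linear_combination (-(((-1 : ℂ) ^ pmP k) ^ 2 * ((5 : ℂ) ^ (2 ^ hexp k - pmM k)) ^ 2)) * (hn.trans h25)
    + (-(((5 : ℂ) ^ (2 ^ hexp k - pmM k)) ^ 2 * ((5 : ℂ) ^ pmM k) ^ 2)) * hs
    + (((-1 : ℂ) ^ pmP k) ^ 2 * ((5 : ℂ) ^ (2 ^ hexp k - pmM k)) ^ 2 * ((((uv (pmM k)).2 : ℤ) : ℂ)) ^ 2) * I_sq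

/-- The norms of `c_k` and `c̄_k` are `5^E`. -/
theorem norm_cB (k : ℕ) (ε : ℂ) (hε : ε = I ∨ ε = -I) :
    ‖(-1 : ℂ) ^ pmP k * (5 : ℂ) ^ (2 ^ hexp k - pmM k) *
        ((((uv (pmM k)).1 : ℤ) : ℂ) + (((uv (pmM k)).2 : ℤ) : ℂ) * ε)‖ = (5 : ℝ) ^ (2 ^ hexp k) := by
  have huv : ‖((((uv (pmM k)).1 : ℤ) : ℂ) + (((uv (pmM k)).2 : ℤ) : ℂ) * ε)‖ = (5 : ℝ) ^ pmM k := by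
    rcases hε with h | h
    · rw [h, uv_spec, norm_pow, norm_three_add_four_I]
    · rw [h, show ((((uv (pmM k)).1 : ℤ) : ℂ) + (((uv (pmM k)).2 : ℤ) : ℂ) * -I) =
          ((((uv (pmM k)).1 : ℤ) : ℂ) - (((uv (pmM k)).2 : ℤ) : ℂ) * I) by ring, uv_conj, norm_pow]
      have h' : ‖(3 : ℂ) - 4 * I‖ = 5 := by
        have h := Complex.norm_add_mul_I 3 (-4)
        push_cast at h
        rw [show (3 : ℂ) - 4 * I = 3 + -4 * I by ring, h,
          show (3 : ℝ) ^ 2 + (-4) ^ 2 = 5 ^ 2 by norm_num, Real.sqrt_sq (by norm_num)]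
      rw [h']
  rw [norm_mul, norm_mul, huv, norm_pow, norm_neg, norm_one, one_pow, one_mul, norm_pow,
    show ‖(5 : ℂ)‖ = 5 by simp, pow_sub_mul_pow _ (pmM_le_pow k)]

/-- Every complex root of `Ξ_k` has modulus `5`. -/
theorem norm_eq_five_of_aeval_Xi {k : ℕ} {w : ℂ} (hw : Polynomial.aeval w (Xi k) = 0) : ‖w‖ = 5 := by
  rw [aeval_Xi] at hw
  have hE : (2 ^ hexp k : ℕ) ≠ 0 := by positivity
  rcases mul_eq_zero.mp hw with h | h
  · have h' := congrArg (fun z : ℂ => ‖z‖) (sub_eq_zero.mp h)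
    simp only [norm_pow] at h'
    rw [norm_cB k I (Or.inl rfl)] at h'
    exact (pow_left_inj₀ (norm_nonneg _) (by norm_num) hE).mp h'
  · have h' := congrArg (fun z : ℂ => ‖z‖) (sub_eq_zero.mp h)
    simp only [norm_pow] at h'
    rw [show ((((uv (pmM k)).1 : ℤ) : ℂ) - (((uv (pmM k)).2 : ℤ) : ℂ) * I) =
        ((((uv (pmM k)).1 : ℤ) : ℂ) + (((uv (pmM k)).2 : ℤ) : ℂ) * -I) by ring,
      norm_cB k (-I) (Or.inr rfl)] at h'
    exact (pow_left_inj₀ (norm_nonneg _) (by norm_num) hE).mp h'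

/-- `5 γ_k` is a root of `Ξ_k`. -/
theorem aeval_Xi_gam (k : ℕ) : Polynomial.aeval (5 * gam ell aB bB k) (Xi k) = 0 := by
  rw [aeval_Xi, gam_pow, cB_eq, sub_self, zero_mul]

/-- `5 γ_k` is an algebraic integer. -/
theorem isIntegral_gam (k : ℕ) : IsIntegral ℤ (5 * gam ell aB bB k) := by
  refine IsIntegral.of_pow (n := 2 ^ hexp k) (by positivity) ?_
  rw [gam_pow]
  refine IsIntegral.mul (IsIntegral.mul ?_ ?_) ?_
  · exact (isIntegral_one.neg).pow _
  · simpa using (isIntegral_intCast 5).pow (2 ^ hexp k - pmM k)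
  · refine IsIntegral.pow ?_ _
    have h3 := isIntegral_intCast 3
    have h4 := isIntegral_intCast 4
    push_cast at h3 h4
    exact h3.add (h4.mul isIntegral_I)

/-- The finite set of complex numbers that are roots of an integer polynomial of degree `≤ D` with all
coefficients of absolute value `≤ 5^D · C(D, D/2)`. -/
def smallRoots (D : ℕ) : Set ℂ :=
  ⋃ f : ℤ[X], ⋃ (_ : f.natDegree ≤ D ∧ ∀ i, f.coeff i ∈ (Finset.Icc (-((5 : ℤ) ^ D * D.choose (D / 2)))
      ((5 : ℤ) ^ D * D.choose (D / 2)) : Set ℤ)), (↑(Polynomial.map (algebraMap ℤ ℂ) f).roots.toFinset : Set ℂ)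

/-- The set of roots of bounded height and degree is finite. -/
theorem smallRoots_finite (D : ℕ) : (smallRoots D).Finite := by
  classical
  unfold smallRoots
  exact Polynomial.bUnion_roots_finite (algebraMap ℤ ℂ) D (Finset.finite_toSet _)

/-- **Bounded house ⟹ membership in the finite set.**  If `γ_k` is a root of a non-zero rational polynomial
of degree `≤ D`, then `5 γ_k ∈ smallRoots D`. -/
theorem mem_smallRoots {k D : ℕ} {f : ℚ[X]} (hf : f ≠ 0) (hfD : f.natDegree ≤ D)
    (hfγ : Polynomial.aeval (gam ell aB bB k) f = 0) : 5 * gam ell aB bB k ∈ smallRoots D := by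
  classical
  set x : ℂ := 5 * gam ell aB bB k with hx
  have hint : IsIntegral ℤ x := isIntegral_gam k
  -- the rescaled polynomial `g(X) = f(X/5)` vanishes at `x` and has the same degree
  set g : ℚ[X] := f.comp (Polynomial.C (5⁻¹ : ℚ) * X) with hg
  have hg0 : g ≠ 0 := by
    intro h0
    rcases Polynomial.comp_eq_zero_iff.mp h0 with h1 | ⟨_, h2⟩
    · exact hf h1
    · have := congrArg (fun p : ℚ[X] => p.coeff 1) h2
      simp at this
  have hgdeg : g.natDegree = f.natDegree := by
    rw [hg, Polynomial.natDegree_comp, Polynomial.natDegree_C_mul (by norm_num), Polynomial.natDegree_X,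
      mul_one]
  have hgx : Polynomial.aeval x (g) = 0 := by
    rw [hg, Polynomial.aeval_comp]
    have : Polynomial.aeval x (Polynomial.C (5⁻¹ : ℚ) * X) = gam ell aB bB k := by
      simp [hx]
    rw [this, hfγ]
  -- the minimal polynomials
  set p : ℤ[X] := minpoly ℤ x with hp
  have hpmonic : p.Monic := minpoly.monic hint
  have hpq : minpoly ℚ x = p.map (algebraMap ℤ ℚ) := minpoly.isIntegrallyClosed_eq_field_fractions' ℚ hint
  have hdegQ : (minpoly ℚ x).natDegree ≤ D := by
    have h1 := minpoly.degree_le_of_ne_zero ℚ x hg0 hgx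
    exact (Polynomial.natDegree_le_natDegree h1).trans (hgdeg ▸ hfD)
  have hdegp : p.natDegree ≤ D := by
    have : (p.map (algebraMap ℤ ℚ)).natDegree = p.natDegree :=
      Polynomial.natDegree_map_eq_of_injective (algebraMap ℤ ℚ).injective_int _
    rw [← this, ← hpq]; exact hdegQ
  -- `minpoly ℚ x ∣ Ξ_k`, so every complex root of `p` has modulus 5
  have hdvd : minpoly ℚ x ∣ Xi k := minpoly.dvd ℚ x (aeval_Xi_gam k)
  have hroots : ∀ z ∈ (p.map (algebraMap ℤ ℂ)).roots, ‖z‖ ≤ 5 := by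
    intro z hz
    have hz' : Polynomial.aeval z p = 0 := by
      rw [Polynomial.mem_roots (Polynomial.map_monic_ne_zero hpmonic)] at hz
      rwa [Polynomial.IsRoot.def, Polynomial.eval_map, ← Polynomial.aeval_def] at hz
    have hzQ : Polynomial.aeval z (minpoly ℚ x) = 0 := by
      rw [hpq, Polynomial.aeval_map_algebraMap]; exact hz'
    obtain ⟨r, hr⟩ := hdvd
    have hzXi : Polynomial.aeval z (Xi k) = 0 := by rw [hr, map_mul, hzQ, zero_mul]
    exact (norm_eq_five_of_aeval_Xi hzXi).le
  -- coefficient bound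
  have hcoeff : ∀ i, p.coeff i ∈ (Finset.Icc (-((5 : ℤ) ^ D * D.choose (D / 2)))
      ((5 : ℤ) ^ D * D.choose (D / 2)) : Set ℤ) := by
    intro i
    have h := Polynomial.coeff_bdd_of_roots_le (algebraMap ℤ ℂ) hpmonic (IsAlgClosed.splits _) hdegp hroots i
    rw [Polynomial.coeff_map, show max (5 : ℝ) 1 = 5 by norm_num] at h
    have h' : |((p.coeff i : ℤ) : ℝ)| ≤ (5 : ℝ) ^ D * D.choose (D / 2) := by
      simpa using h
    have h'' : |p.coeff i| ≤ (5 : ℤ) ^ D * D.choose (D / 2) := by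
      have : ((|p.coeff i| : ℤ) : ℝ) ≤ (((5 : ℤ) ^ D * D.choose (D / 2) : ℤ) : ℝ) := by push_cast; exact h'
      exact_mod_cast this
    simp only [Finset.coe_Icc, Set.mem_Icc]
    constructor <;> linarith [abs_le.mp h'']
  -- membership
  unfold smallRoots
  simp only [Set.mem_iUnion]
  refine ⟨p, ⟨hdegp, hcoeff⟩, ?_⟩
  rw [Finset.mem_coe, Multiset.mem_toFinset, Polynomial.mem_roots (Polynomial.map_monic_ne_zero hpmonic),
    Polynomial.IsRoot.def, Polynomial.eval_map, ← Polynomial.aeval_def, hp]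
  exact minpoly.aeval ℤ x

/-- The arguments `r_k = a_k π + b_k ℓ₀` increase strictly. -/
theorem arg_strictMono : StrictMono fun k => (aB k : ℝ) * Real.pi + (bB k : ℝ) * ell := by
  refine strictMono_nat_of_lt_succ fun k => ?_
  simp only [approx_eq, Finset.sum_range_succ _ (k + 1)]
  have := ytx_pos tau_pos (k + 1)
  nlinarith [Real.pi_pos]

/-- The staircase argument `a_k π + b_k ℓ₀` is positive. -/
theorem arg_pos (k : ℕ) : 0 < (aB k : ℝ) * Real.pi + (bB k : ℝ) * ell := by
  rw [approx_eq]
  exact mul_pos Real.pi_pos (Finset.sum_pos (fun i _ => ytx_pos tau_pos i) ⟨0, by simp⟩)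

/-- The staircase argument is below `2π`. -/
theorem arg_lt (k : ℕ) : (aB k : ℝ) * Real.pi + (bB k : ℝ) * ell < 2 * Real.pi := by
  have h1 := err_pos k
  have h2 : yB ≤ Real.pi * (3 / 2) := by
    unfold yB
    refine mul_le_mul_of_nonneg_left ?_ Real.pi_pos.le
    calc yx tau = ∑' k, ytx tau (k + 0) := by simp [yx]
      _ ≤ (3 / 2) * (2 * (1 / (2 : ℝ) ^ hexp 0)) := yx_tail_le tau_pos.le tau_le 0
      _ = 3 / 2 := by simp
  nlinarith [Real.pi_pos]

/-- `k ↦ γ_k` is injective (the arguments lie in `(0, 2π)` and increase strictly). -/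
theorem gam_injective : Function.Injective (gam ell aB bB) := by
  intro j k hjk
  unfold gam at hjk
  obtain ⟨n, hn⟩ := Complex.exp_eq_exp_iff_exists_int.mp hjk
  have hre := congrArg Complex.im hn
  simp at hre
  -- hre : r_j = r_k + n * (2π)
  have hj1 := arg_pos j; have hj2 := arg_lt j; have hk1 := arg_pos k; have hk2 := arg_lt k
  have hn0 : n = 0 := by
    by_contra h0
    rcases lt_or_gt_of_ne h0 with hneg | hpos
    · have : (n : ℝ) ≤ -1 := by exact_mod_cast Int.le_sub_one_of_lt hneg
      nlinarith [Real.pi_pos]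
    · have : (1 : ℝ) ≤ n := by exact_mod_cast hpos
      nlinarith [Real.pi_pos]
  rw [hn0] at hre
  simp at hre
  exact arg_strictMono.injective hre

/-- **`DegGrowth` for the member**: the degrees of the algebraic numbers `γ_k` tend to infinity. -/
theorem degGrowth_B : DegGrowth (gam ell aB bB) := by
  intro D
  have hfin : ((fun k => 5 * gam ell aB bB k) ⁻¹' smallRoots D).Finite :=
    (smallRoots_finite D).preimage fun j _ k _ hjk => gam_injective (mul_left_cancel₀ (by norm_num) hjk)
  have hev := hfin.eventually_cofinite_notMem
  rw [Nat.cofinite_eq_atTop] at hev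
  filter_upwards [hev] with k hk f hf hfD hfγ
  exact hk (mem_smallRoots hf hfD hfγ)

/-! ### §D.4  The member's cell theorem -/

/-- `b_k > 0` eventually. -/
theorem bB_pos : ∀ᶠ k in atTop, 0 < bB k := by
  filter_upwards [eventually_ge_atTop 1] with k hk
  unfold bB
  exact div_pos (by exact_mod_cast one_le_pmM hk) (by positivity)

/-- **THE BILOG STAIRCASE CELL AT ITS MEMBER (kernel-checked reduction):**
`TransferI → TransferII → SB 3 z_B`. -/
theorem sb_three_zB_of (hI : TransferI) (hII : TransferII) : SB 3 zB :=
  sb_three_of_transfer hI hII isAlgebraic_cexp_ell hyperStair_B degGrowth_B bB_pos flat_B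

end Bilog
end LatCell
end HyperCell
end Summit.Schanuel.Schanuel.Theorems.RootDecomp1KHyper
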